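import Literature.MathematicalPhysics.QuantumFieldTheory.VillainCoulombGas
import Literature.Probability.LatticeModels.DiracCombResummation
import Mathlib.Analysis.SpecialFunctions.Integrals.Basic
import Mathlib.MeasureTheory.Integral.Pi
import HarnessLib

/-!
# The monopole gas of the Villain model on a cube as a Gaussian-and-torus average of products over
# cubes (Kac–Siegert with the full Laplacian, closedness by characters of a torus, and the
# Fröhlich–Spencer `z_q` resummation) — regulator-free form of FS82 (2.40), (2.43)–(2.44)

Support file for the Coulomb-gas (monopole) representation of four-dimensional `U(1)` lattice gauge
theory with the Villain action (proof programme of the named fact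
`Literature.MathematicalPhysics.QuantumFieldTheory.FrohlichSpencerU1PerimeterLawD4` and of its
corollary `Literature.Barriers.QuantumFields.AbelianDeconfinementD4`). The exact gas
`gasNum β S = ∑_{q closed} e^{-2π²β⟨q,B'⁻¹q⟩} cos(2π⟨q, B'⁻¹DS⟩)` (`VillainCoulombGas`, `B' = DDᵀ + EᵀE`)
is rewritten, as in FS82 §2.6, as a convex combination over multiplicities `κ ∈ ℕ^{cubes}` of
averages of PRODUCTS OVER CUBES — the input of Lemma 2 — where (i) the Coulomb weight is the
characteristic function of the Gaussian field `a ∼ N(0, 4π²β B'⁻¹)` on the cubes (Kac–Siegert),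
(ii) the closedness constraint `dq = 0` is the character integral `∫_{[0,1)^{4-cells}} e^{2πi⟨b, dq⟩} db`
over a torus variable `b` on the 4-cells (so that, under the expansion into ensembles, only CLOSED
current densities survive — FS82 (2.43)–(2.44) — while the per-cube product structure is kept), and
(iii) the sum over `q ∈ ℤ^{cubes}` is resummed by `DiracCombResummation` (`u_k = 2/z_k`):

* `lapV`, `auxPrec β = (4π²β)⁻¹ B'`, `auxZ`, `auxShift S = 2π B'⁻¹DS`, `torusShift b = 2π Eᵀb`,
  `auxGauss`; `integral_auxGauss_cexp` (Kac–Siegert), `integral_torus_cexp` (characters of the torus),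
  `EInt`/`isClosedFlux_iff_EInt_eq_zero`;
* `ksTerm` (`= [q closed] gasWeight q e^{2πi⟨q,B'⁻¹DS⟩}`), `re_ksTerm`, `gasNum_eq_re_tsum`;
* `uSeq`/`uR`, `sum_pairWeight_cexp`, `sum_pairWeight_ksTerm`, and **`gasNum_eq_tsum_kappa`**:
  `gasNum β S = ∑_κ (∏_c u_{κ_c}) Z⁻¹ ∫_{[0,1)^{4-cells}} ∫ e^{-½aᵀPa} ∏_c (1 + z_{κ_c} cos(κ_c(a_c + ψ_c + 2π(Eᵀb)_c))) da db`,
  `gasDen_eq_tsum_kappa`.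

Everything is proved; no named fact is introduced.

## References

* J. Fröhlich, T. Spencer, Comm. Math. Phys. 83 (1982) 411–454, §2.5 (2.33)–(2.35), §2.6
  (2.36)–(2.44). [FrohlichSpencerCMP1982]
-/

noncomputable section

open Finset Function Matrix Filter Topology MeasureTheory Complex Set
open scoped Real ENNReal
open Literature.Probability.LatticeModels
open Literature.Probability.LatticeModels.GaussianCoord (gram exactPart perpPart lap)
open Literature.Probability.LatticeModels.EnsembleExpansion (signMul sum_signType
  tsum_eq_tsum_pairWeight_of_summable)
open Literature.MathematicalPhysics.QuantumFieldTheory.GaussianToolkit (gaussZ)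

namespace Literature.MathematicalPhysics.QuantumFieldTheory

namespace VillainAngle

open AxialGauge LatticeForm LatticeChain VillainFibre

variable {d n : ℕ}

/-! ### The auxiliary Gaussian field on the cubes and the torus variable on the 4-cells -/

/-- The full Laplacian of the Villain model on the cube. [cite: FrohlichSpencerCMP1982, §2.5 (2.35)] -/
def lapV : Matrix (CIdx d n) (CIdx d n) ℝ := lap (DMat (d := d) (n := n)) (EMat (d := d) (n := n))

/-- `lapV` is positive definite. [folklore] -/
theorem posDef_lapV : (lapV (d := d) (n := n)).PosDef := posDef_villainLap

/-- **The auxiliary precision** `P = (4π²β)⁻¹ B'`: the Gaussian field `a` on the cubes with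
`E e^{i⟨q,a⟩} = e^{-2π²β ⟨q, B'⁻¹q⟩}`. [cite: FrohlichSpencerCMP1982, §2.5 (2.32)–(2.33)] -/
def auxPrec (β : ℝ) : Matrix (CIdx d n) (CIdx d n) ℝ := (4 * π ^ 2 * β)⁻¹ • lapV

/-- `P` is positive definite (`β > 0`). [folklore] -/
theorem posDef_auxPrec {β : ℝ} (hβ : 0 < β) : (auxPrec (d := d) (n := n) β).PosDef :=
  posDef_lapV.smul (by positivity)

/-- `P⁻¹ = 4π²β B'⁻¹`. [folklore] -/
theorem inv_auxPrec {β : ℝ} (hβ : 0 < β) :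
    (auxPrec (d := d) (n := n) β)⁻¹ = (4 * π ^ 2 * β) • (lapV)⁻¹ := by
  have hc : (4 * π ^ 2 * β) ≠ 0 := by positivity
  have hdet : IsUnit (lapV (d := d) (n := n)).det :=
    (Matrix.isUnit_iff_isUnit_det _).1 posDef_lapV.isUnit
  rw [auxPrec]
  refine Matrix.inv_eq_left_inv ?_
  rw [Matrix.smul_mul, Matrix.mul_smul, smul_smul, mul_inv_cancel₀ hc, one_smul,
    Matrix.nonsing_inv_mul _ hdet]

/-- The normalisation `Z = ∫ e^{-½aᵀPa} da > 0`. [folklore] -/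
def auxZ (β : ℝ) : ℝ := (gaussZ (auxPrec (d := d) (n := n) β)).toReal

/-- `Z > 0`. [folklore] -/
theorem auxZ_pos {β : ℝ} (hβ : 0 < β) : 0 < auxZ (d := d) (n := n) β :=
  GaussianCoord.gaussZ_toReal_pos _ (posDef_auxPrec hβ)

/-- **The shift** `ψ = 2π B'⁻¹ D S` carrying the Wilson-loop sheet into the phases.
[cite: FrohlichSpencerCMP1982, §2.7 (2.52)–(2.56)] -/
def auxShift (S : PIdx d n → ℝ) : CIdx d n → ℝ := (2 * π) • ((lapV)⁻¹ *ᵥ (DMat *ᵥ S))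

/-- `ψ(0) = 0`. [folklore] -/
@[simp] theorem auxShift_zero : auxShift (d := d) (n := n) 0 = 0 := by simp [auxShift]

/-- **The torus shift** `2π Eᵀb` of a torus variable `b` on the 4-cells. [folklore] -/
def torusShift (b : QIdx d n → ℝ) : CIdx d n → ℝ := (2 * π) • ((EMat (d := d) (n := n))ᵀ *ᵥ b)

/-- The torus shift is continuous. [folklore] -/
theorem continuous_torusShift : Continuous (torusShift (d := d) (n := n)) := by
  unfold torusShift
  exact (continuous_const.matrix_mulVec continuous_id).const_smul (2 * π)

/-- The Gaussian weight `e^{-½aᵀPa}`. [folklore] -/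
def auxGauss (β : ℝ) (a : CIdx d n → ℝ) : ℝ := Real.exp (-(a ⬝ᵥ auxPrec β *ᵥ a) / 2)

/-- The Gaussian weight is positive. [folklore] -/
theorem auxGauss_pos (β : ℝ) (a : CIdx d n → ℝ) : 0 < auxGauss β a := Real.exp_pos _

/-- The Gaussian weight is continuous. [folklore] -/
theorem continuous_auxGauss (β : ℝ) : Continuous (auxGauss (d := d) (n := n) β) := by
  unfold auxGauss
  refine Real.continuous_exp.comp ((Continuous.neg ?_).div_const _)
  exact continuous_id.dotProduct (continuous_const.matrix_mulVec continuous_id)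

/-- The Gaussian weight is integrable (`β > 0`). [folklore] -/
theorem integrable_auxGauss {β : ℝ} (hβ : 0 < β) : Integrable (auxGauss (d := d) (n := n) β) :=
  GaussianCoord.integrable_exp_quadratic _ (posDef_auxPrec hβ)

/-! ### Kac–Siegert -/

/-- **Kac–Siegert representation (complex form)**:
`∫ e^{-½aᵀPa} e^{i⟨q, a + ψ⟩} da = Z e^{-2π²β⟨q,B'⁻¹q⟩} e^{i⟨q,ψ⟩}`. [cite: FrohlichSpencerCMP1982, §2.5 (2.33)] -/
theorem integral_auxGauss_cexp {β : ℝ} (hβ : 0 < β) (q ψ : CIdx d n → ℝ) :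
    ∫ a, (auxGauss β a : ℂ) * cexp (I * ((q ⬝ᵥ (a + ψ) : ℝ) : ℂ)) =
      (auxZ (d := d) (n := n) β : ℂ) * (Real.exp (-(2 * π ^ 2 * β) * (q ⬝ᵥ ((lapV)⁻¹ *ᵥ q))) : ℂ) *
        cexp (I * ((q ⬝ᵥ ψ : ℝ) : ℂ)) := by
  have hsplit : ∀ a : CIdx d n → ℝ, (auxGauss β a : ℂ) * cexp (I * ((q ⬝ᵥ (a + ψ) : ℝ) : ℂ)) =
      ((Real.exp (-(a ⬝ᵥ auxPrec β *ᵥ a) / 2) : ℂ) * cexp (I * ((q ⬝ᵥ a : ℝ) : ℂ))) *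
        cexp (I * ((q ⬝ᵥ ψ : ℝ) : ℂ)) := by
    intro a
    rw [auxGauss, dotProduct_add, Complex.ofReal_add, mul_add, Complex.exp_add, mul_assoc]
  simp_rw [hsplit]
  rw [integral_mul_const, GaussianCoord.integral_exp_quadratic_mul_cexp _ (posDef_auxPrec hβ) q,
    inv_auxPrec hβ, Matrix.smul_mulVec, dotProduct_smul, smul_eq_mul, auxZ]
  congr 1
  congr 1
  rw [Complex.ofReal_exp]
  congr 1
  push_cast
  ring

/-! ### Characters of the torus: the closedness constraint -/

/-- `∫₀¹ e^{2πi k t} dt = [k = 0]` for an integer `k`. [folklore] -/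
theorem integral_cexp_two_pi_mul_int (k : ℤ) :
    ∫ t in Ico (0 : ℝ) 1, cexp (2 * π * I * k * t) = if k = 0 then 1 else 0 := by
  split_ifs with hk
  · subst hk
    simp only [Int.cast_zero, mul_zero, zero_mul, Complex.exp_zero, setIntegral_const, Measure.real, Real.volume_Ico,
      sub_zero, ENNReal.toReal_ofReal zero_le_one, one_smul]
  · have hc : (2 * π * I * k : ℂ) ≠ 0 := by
      have : (k : ℂ) ≠ 0 := by exact_mod_cast hk
      have hπ : (π : ℂ) ≠ 0 := by exact_mod_cast Real.pi_ne_zero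
      simp [this, hπ, Complex.I_ne_zero]
    have heq : (fun t : ℝ => cexp (2 * π * I * k * t)) = fun t : ℝ => cexp ((2 * π * I * k) * (t : ℂ)) := by
      funext t; ring_nf
    rw [integral_Ico_eq_integral_Ioc, ← intervalIntegral.integral_of_le zero_le_one, heq, integral_exp_mul_complex hc,
      show (2 * π * I * k : ℂ) * ((1 : ℝ) : ℂ) = k * (2 * π * I) by push_cast; ring, Complex.exp_int_mul_two_pi_mul_I]
    simp

/-- **Characters of the torus**: for an integer vector `k` on the 4-cells,
`∫_{[0,1)^Q} e^{2πi ⟨k, b⟩} db = [k = 0]`. [cite: FrohlichSpencerCMP1982, §2.6 (2.43)–(2.44) (the constraint δρ = 0)] -/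
theorem integral_torus_cexp (k : QIdx d n → ℤ) :
    ∫ b in Set.pi univ (fun _ : QIdx d n => Ico (0 : ℝ) 1), cexp (I * ((2 * π * ∑ σ, (k σ : ℝ) * b σ : ℝ) : ℂ)) =
      if k = 0 then 1 else 0 := by
  have hprod : ∀ b : QIdx d n → ℝ, cexp (I * ((2 * π * ∑ σ, (k σ : ℝ) * b σ : ℝ) : ℂ)) =
      ∏ σ, cexp (2 * π * I * (k σ) * (b σ)) := by
    intro b
    rw [← Complex.exp_sum]
    congr 1
    push_cast
    rw [Finset.mul_sum, Finset.mul_sum]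
    exact Finset.sum_congr rfl fun σ _ => by ring
  simp_rw [hprod]
  rw [show (volume : Measure (QIdx d n → ℝ)).restrict (Set.pi univ fun _ => Ico (0 : ℝ) 1) =
      Measure.pi fun _ : QIdx d n => (volume : Measure ℝ).restrict (Ico 0 1) by
    rw [volume_pi, Measure.restrict_pi_pi],
    integral_fintype_prod_eq_prod (f := fun σ (t : ℝ) => cexp (2 * π * I * (k σ) * (t : ℂ)))]
  simp_rw [integral_cexp_two_pi_mul_int]
  by_cases hk : k = 0
  · subst hk; simp
  · rw [if_neg hk]
    obtain ⟨σ, hσ⟩ : ∃ σ, k σ ≠ 0 := Function.ne_iff.1 hk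
    exact Finset.prod_eq_zero (Finset.mem_univ σ) (if_neg hσ)

/-- The integer coboundary of an integer cube field on the 4-cells of the box. [folklore] -/
def EInt (q : CIdx d n → ℤ) : QIdx d n → ℤ :=
  fun σ => cd₃ (extCubeA q) σ.1.1 σ.1.2.1 σ.1.2.2.1 σ.1.2.2.2.1 σ.1.2.2.2.2

/-- `d(cast q) = cast (dq)` on 4-cells. [folklore] -/
theorem cd₃_extCubeA_intCast (q : CIdx d n → ℤ) (x : Literature.Probability.LatticeModels.Site d) (i j k l : Fin d) :
    cd₃ (extCubeA (fun c => (q c : ℝ))) x i j k l = ((cd₃ (extCubeA q) x i j k l : ℤ) : ℝ) := by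
  have hext : extCubeA (fun c : CIdx d n => (q c : ℝ)) = fun y a b c => ((extCubeA (A := ℤ) q y a b c : ℤ) : ℝ) := by
    funext y a b c; simp only [extCubeA]; split_ifs <;> simp
  rw [hext]
  simp only [cd₃]
  push_cast
  ring

/-- `E(cast q) = cast (EInt q)`. [folklore] -/
theorem EMat_mulVec_intCast (q : CIdx d n → ℤ) :
    EMat *ᵥ (fun c => (q c : ℝ)) = fun σ => (EInt q σ : ℝ) := by
  rw [EMat_mulVec]
  funext σ
  rw [cobd₃_apply, EInt, cd₃_extCubeA_intCast]

/-- `q` is closed iff `EInt q = 0`. [folklore] -/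
theorem isClosedFlux_iff_EInt_eq_zero (q : CIdx d n → ℤ) : IsClosedFlux q ↔ EInt q = 0 := by
  constructor
  · intro h
    funext σ
    obtain ⟨⟨x, i, j, k, l⟩, hσ⟩ := σ
    obtain ⟨hx, hij, hjk, hkl, hx4⟩ := mem_fourCellsIn.1 hσ
    exact h x i j k l (Fin.lt_def.1 hij) (Fin.lt_def.1 hjk) (Fin.lt_def.1 hkl) hx hx4
  · intro h x i j k l hij hjk hkl hx hx4
    have hσ : (x, i, j, k, l) ∈ fourCellsIn d n :=
      mem_fourCellsIn.2 ⟨hx, Fin.lt_def.2 hij, Fin.lt_def.2 hjk, Fin.lt_def.2 hkl, hx4⟩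
    have := congrFun h ⟨(x, i, j, k, l), hσ⟩
    simpa [EInt] using this

/-- `⟨q, 2πEᵀb⟩ = 2π ⟨Eq, b⟩`. [folklore] -/
theorem dotProduct_torusShift (q : CIdx d n → ℝ) (b : QIdx d n → ℝ) :
    q ⬝ᵥ torusShift b = 2 * π * ((EMat *ᵥ q) ⬝ᵥ b) := by
  unfold torusShift
  rw [dotProduct_smul, GaussianCoord.mulVec_dotProduct_eq, smul_eq_mul]

open Classical in
/-- **The closedness indicator as a torus integral**: for an integer cube field `q`,
`∫_{[0,1)^Q} e^{i⟨q, 2πEᵀb⟩} db = [q closed]`. [cite: FrohlichSpencerCMP1982, §2.6 (2.43)–(2.44)] -/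
theorem integral_torus_cexp_intCast (q : CIdx d n → ℤ) :
    ∫ b in Set.pi univ (fun _ : QIdx d n => Ico (0 : ℝ) 1),
        cexp (I * (((fun c => (q c : ℝ)) ⬝ᵥ torusShift b : ℝ) : ℂ)) =
      if IsClosedFlux q then 1 else 0 := by
  have h : ∀ b, ((fun c => (q c : ℝ)) ⬝ᵥ torusShift b : ℝ) = 2 * π * ∑ σ, (EInt q σ : ℝ) * b σ := by
    intro b; rw [dotProduct_torusShift, EMat_mulVec_intCast, dotProduct]
  simp_rw [h]
  rw [integral_torus_cexp]
  exact if_congr (isClosedFlux_iff_EInt_eq_zero q).symm rfl rfl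

/-! ### The complex gas term -/

/-- The complex Kac–Siegert integrand is continuous. [folklore] -/
theorem continuous_ksIntegrand (β : ℝ) (q ψ : CIdx d n → ℝ) :
    Continuous fun a : CIdx d n → ℝ => (auxGauss β a : ℂ) * cexp (I * ((q ⬝ᵥ (a + ψ) : ℝ) : ℂ)) := by
  refine (continuous_ofReal.comp (continuous_auxGauss β)).mul (Complex.continuous_exp.comp ?_)
  refine continuous_const.mul (continuous_ofReal.comp ?_)
  exact continuous_const.dotProduct (continuous_id.add continuous_const)

/-- The complex Kac–Siegert integrand is integrable (`β > 0`). [folklore] -/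
theorem integrable_ksIntegrand {β : ℝ} (hβ : 0 < β) (q ψ : CIdx d n → ℝ) :
    Integrable fun a : CIdx d n → ℝ => (auxGauss β a : ℂ) * cexp (I * ((q ⬝ᵥ (a + ψ) : ℝ) : ℂ)) := by
  refine (integrable_auxGauss hβ).mono' (continuous_ksIntegrand β q ψ).aestronglyMeasurable
    (Filter.Eventually.of_forall fun a => ?_)
  rw [norm_mul, Complex.norm_real, Real.norm_eq_abs, abs_of_pos (auxGauss_pos β a), mul_comm I,
    Complex.norm_exp_ofReal_mul_I, mul_one]

/-- **The complex `q`-th term**: `T(q) = Z⁻¹ (∫ e^{-½aᵀPa} e^{i⟨q, a + ψ⟩} da) (∫_{[0,1)^Q} e^{i⟨q,2πEᵀb⟩} db)`. [folklore] -/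
def ksTerm (β : ℝ) (S : PIdx d n → ℝ) (q : CIdx d n → ℤ) : ℂ :=
  ((auxZ (d := d) (n := n) β)⁻¹ : ℂ) *
    ((∫ a, (auxGauss β a : ℂ) * cexp (I * (((fun c => (q c : ℝ)) ⬝ᵥ (a + auxShift S) : ℝ) : ℂ))) *
      ∫ b in Set.pi univ (fun _ : QIdx d n => Ico (0 : ℝ) 1),
        cexp (I * (((fun c => (q c : ℝ)) ⬝ᵥ torusShift b : ℝ) : ℂ)))

/-- `⟨q, ψ⟩ = 2π ⟨q, B'⁻¹DS⟩`. [folklore] -/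
theorem dotProduct_auxShift (q : CIdx d n → ℝ) (S : PIdx d n → ℝ) :
    q ⬝ᵥ auxShift S = 2 * π * (q ⬝ᵥ ((lapV (d := d) (n := n))⁻¹ *ᵥ (DMat *ᵥ S))) := by
  rw [auxShift, dotProduct_smul, smul_eq_mul]

/-- `gasWeight` in terms of `lapV`. [folklore] -/
theorem gasWeight_eq (β : ℝ) (q : CIdx d n → ℤ) :
    gasWeight β q = Real.exp (-(2 * π ^ 2 * β) * ((fun c => (q c : ℝ)) ⬝ᵥ ((lapV (d := d) (n := n))⁻¹ *ᵥ fun c => (q c : ℝ)))) := rfl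

open Classical in
/-- **`T(q) = [q closed] gasWeight(q) e^{2πi⟨q, B'⁻¹DS⟩}`.** [folklore] -/
theorem ksTerm_eq {β : ℝ} (hβ : 0 < β) (S : PIdx d n → ℝ) (q : CIdx d n → ℤ) :
    ksTerm β S q = if IsClosedFlux q then (gasWeight β q : ℂ) *
      cexp (I * ((2 * π * ((fun c => (q c : ℝ)) ⬝ᵥ ((lapV (d := d) (n := n))⁻¹ *ᵥ (DMat *ᵥ S))) : ℝ) : ℂ)) else 0 := by
  have hZ : ((auxZ (d := d) (n := n) β : ℝ) : ℂ) ≠ 0 := by exact_mod_cast (auxZ_pos (d := d) (n := n) hβ).ne'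
  rw [ksTerm, integral_auxGauss_cexp hβ, dotProduct_auxShift, integral_torus_cexp_intCast, gasWeight_eq]
  split_ifs
  · rw [mul_one, ← mul_assoc, ← mul_assoc, inv_mul_cancel₀ hZ, one_mul]
  · rw [mul_zero, mul_zero]

/-- `Re T(q)` is the `q`-th term of `gasNum`. [folklore] -/
theorem re_ksTerm {β : ℝ} (hβ : 0 < β) (S : PIdx d n → ℝ) (q : CIdx d n → ℤ) :
    (ksTerm β S q).re = gasTerm β S q := by
  classical
  rw [ksTerm_eq hβ, gasTerm]
  split_ifs
  · rw [Complex.re_ofReal_mul, mul_comm I, Complex.exp_ofReal_mul_I_re]; rfl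
  · rfl

/-- `‖T(q)‖ = [q closed] gasWeight(q) = gasTerm β 0 q`. [folklore] -/
theorem norm_ksTerm {β : ℝ} (hβ : 0 < β) (S : PIdx d n → ℝ) (q : CIdx d n → ℤ) :
    ‖ksTerm β S q‖ = gasTerm β 0 q := by
  classical
  rw [ksTerm_eq hβ, gasTerm]
  split_ifs
  · rw [norm_mul, Complex.norm_real, Real.norm_eq_abs, abs_of_pos (gasWeight_pos β q), mul_comm I,
      Complex.norm_exp_ofReal_mul_I, Matrix.mulVec_zero, Matrix.mulVec_zero, dotProduct_zero, mul_zero,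
      Real.cos_zero]
  · rw [norm_zero]

/-- The complex gas is absolutely summable (`β > 0`). [folklore] -/
theorem summable_norm_ksTerm {β : ℝ} (hβ : 0 < β) (S : PIdx d n → ℝ) :
    Summable fun q : CIdx d n → ℤ => ‖ksTerm β S q‖ := by
  simp_rw [norm_ksTerm hβ]
  exact summable_gasTerm hβ 0

/-- **`gasNum` is the real part of the complex gas.** [folklore] -/
theorem gasNum_eq_re_tsum {β : ℝ} (hβ : 0 < β) (S : PIdx d n → ℝ) :
    gasNum β S = (∑' q : CIdx d n → ℤ, ksTerm β S q).re := by
  rw [Complex.re_tsum (summable_norm_ksTerm hβ S).of_norm, gasNum]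
  exact tsum_congr fun q => (re_ksTerm hβ S q).symm

/-! ### The `z_q` resummation -/

/-- **The resummation weights** `u_k = 2/z_k` (`k ≥ 1`), `u_0 = 0`. [cite: FrohlichSpencerCMP1982, §2.6 (2.37)–(2.38)] -/
def uSeq (z : ℕ → ℝ) (k : ℕ) : ℝ≥0∞ := if k = 0 then 0 else ENNReal.ofReal (2 / z k)

/-- The real weights `u_k`. [folklore] -/
def uR (z : ℕ → ℝ) (k : ℕ) : ℝ := if k = 0 then 0 else 2 / z k

/-- `u_k ≥ 0` for positive `z`. [folklore] -/
theorem uR_nonneg {z : ℕ → ℝ} (hz : ∀ k, 0 < z k) (k : ℕ) : 0 ≤ uR z k := by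
  unfold uR; split_ifs
  · rfl
  · have := hz k; positivity

/-- `(u_k).toReal = uR k`. [folklore] -/
theorem uSeq_toReal {z : ℕ → ℝ} (hz : ∀ k, 0 < z k) (k : ℕ) : (uSeq z k).toReal = uR z k := by
  unfold uSeq uR
  split_ifs with h
  · rfl
  · exact ENNReal.toReal_ofReal (by have := hz k; positivity)

/-- `∑ u_k = 1` when `∑_{k≥1} 2/z_k = 1`. [cite: FrohlichSpencerCMP1982, §2.6 (2.38)] -/
theorem tsum_uSeq {z : ℕ → ℝ} (hz : ∀ k, 0 < z k) (hsum : HasSum (uR z) 1) : ∑' k, uSeq z k = 1 := by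
  have h1 : ∀ k, uSeq z k = ENNReal.ofReal (uR z k) := fun k => by
    unfold uSeq uR; split_ifs <;> simp
  simp_rw [h1]
  rw [← ENNReal.ofReal_tsum_of_nonneg (uR_nonneg hz) hsum.summable, hsum.tsum_eq, ENNReal.ofReal_one]

/-- The pair weights in `ℝ`. [folklore] -/
theorem pairWeight_toReal {z : ℕ → ℝ} (hz : ∀ k, 0 < z k) (k : ℕ) (s : SignType) :
    (EnsembleExpansion.pairWeight (uSeq z) k s).toReal = if s = 0 then uR z k else if k = 0 then 0 else 1 := by
  unfold EnsembleExpansion.pairWeight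
  split_ifs <;> simp [uSeq_toReal hz]

/-- **The sign sum at one cube**: `∑_{s} w(κ,s) e^{isκt} = u_κ (1 + z_κ cos(κt))`. [cite: FrohlichSpencerCMP1982, §2.6 (2.39)] -/
theorem sum_pairWeight_cexp {z : ℕ → ℝ} (hz : ∀ k, 0 < z k) (κ : ℕ) (t : ℝ) :
    ∑ s : SignType, ((EnsembleExpansion.pairWeight (uSeq z) κ s).toReal : ℂ) * cexp (I * (((s : ℤ) * κ * t : ℝ) : ℂ)) =
      ((uR z κ * (1 + z κ * Real.cos (κ * t)) : ℝ) : ℂ) := by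
  have h0 : (EnsembleExpansion.pairWeight (uSeq z) κ 0).toReal = uR z κ := by
    rw [pairWeight_toReal hz]; rfl
  have h1 : (EnsembleExpansion.pairWeight (uSeq z) κ 1).toReal = if κ = 0 then 0 else 1 := by
    rw [pairWeight_toReal hz, if_neg (by decide)]
  have hm1 : (EnsembleExpansion.pairWeight (uSeq z) κ (-1)).toReal = if κ = 0 then 0 else 1 := by
    rw [pairWeight_toReal hz, if_neg (by decide)]
  have hcos : cexp (I * ((-(κ * t) : ℝ) : ℂ)) + cexp (I * ((κ * t : ℝ) : ℂ)) = ((2 * Real.cos (κ * t) : ℝ) : ℂ) := by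
    rw [mul_comm I, mul_comm I, Complex.exp_mul_I, Complex.exp_mul_I, Complex.ofReal_neg, Complex.cos_neg,
      Complex.sin_neg]
    push_cast
    ring
  rw [sum_signType, h0, h1, hm1]
  by_cases hκ : κ = 0
  · subst hκ
    simp [uR]
  · rw [if_neg hκ]
    simp only [SignType.coe_zero, SignType.coe_one, SignType.coe_neg_one, Int.cast_zero, Int.cast_one,
      Int.cast_neg, zero_mul, neg_mul, one_mul, Complex.ofReal_zero, mul_zero, Complex.exp_zero, mul_one,
      Complex.ofReal_one]
    rw [add_assoc, hcos]
    have hzκ : (z κ : ℂ) ≠ 0 := by exact_mod_cast (hz κ).ne'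
    simp only [uR, hκ, if_false]
    push_cast
    field_simp

/-- The per-sign joint integrand `(b, a) ↦ e^{-½aᵀPa} ∏_c w_c e^{i s_c κ_c (a_c + ψ_c + 2π(Eᵀb)_c)}`. [folklore] -/
def signIntegrand (β : ℝ) (S : PIdx d n → ℝ) {z : ℕ → ℝ} (κ : CIdx d n → ℕ) (s : CIdx d n → SignType)
    (b : QIdx d n → ℝ) (a : CIdx d n → ℝ) : ℂ :=
  (auxGauss β a : ℂ) * ∏ c, (((EnsembleExpansion.pairWeight (uSeq z) (κ c) (s c)).toReal : ℂ) *
    cexp (I * ((((s c : ℤ) * (κ c) * (a c + auxShift S c + torusShift b c)) : ℝ) : ℂ)))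

/-- **The sign terms as iterated integrals**:
`w(κ,s) T(sκ) = Z⁻¹ ∫_{[0,1)^Q} ∫ signIntegrand db da`. [folklore] -/
theorem pairWeight_smul_ksTerm (β : ℝ) (S : PIdx d n → ℝ) {z : ℕ → ℝ} (κ : CIdx d n → ℕ)
    (s : CIdx d n → SignType) :
    (∏ c, EnsembleExpansion.pairWeight (uSeq z) (κ c) (s c)).toReal • ksTerm β S (signMul s κ) =
      ((auxZ (d := d) (n := n) β)⁻¹ : ℂ) *
        ∫ b in Set.pi univ (fun _ : QIdx d n => Ico (0 : ℝ) 1), ∫ a, signIntegrand β S (z := z) κ s b a := by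
  classical
  -- the `a`-integral of the sign integrand at fixed `b`
  have hinner : ∀ b : QIdx d n → ℝ, ∫ a, signIntegrand β S (z := z) κ s b a =
      (((∏ c, EnsembleExpansion.pairWeight (uSeq z) (κ c) (s c)).toReal : ℝ) : ℂ) *
        ((∫ a, (auxGauss β a : ℂ) *
            cexp (I * (((fun c => ((signMul s κ c : ℤ) : ℝ)) ⬝ᵥ (a + auxShift S) : ℝ) : ℂ))) *
          cexp (I * (((fun c => ((signMul s κ c : ℤ) : ℝ)) ⬝ᵥ torusShift b : ℝ) : ℂ))) := by
    intro b
    rw [← integral_mul_const, ← integral_const_mul]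
    refine integral_congr_ae (Filter.Eventually.of_forall fun a => ?_)
    simp only [signIntegrand]
    rw [Finset.prod_mul_distrib, ENNReal.toReal_prod, Complex.ofReal_prod]
    have hexp : ∏ c, cexp (I * ((((s c : ℤ) * (κ c) * (a c + auxShift S c + torusShift b c)) : ℝ) : ℂ)) =
        cexp (I * (((fun c => ((signMul s κ c : ℤ) : ℝ)) ⬝ᵥ (a + auxShift S) : ℝ) : ℂ)) *
          cexp (I * (((fun c => ((signMul s κ c : ℤ) : ℝ)) ⬝ᵥ torusShift b : ℝ) : ℂ)) := by
      rw [← Complex.exp_sum, ← Complex.exp_add]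
      congr 1
      rw [dotProduct, dotProduct, Complex.ofReal_sum, Complex.ofReal_sum, Finset.mul_sum, Finset.mul_sum,
        ← Finset.sum_add_distrib]
      refine Finset.sum_congr rfl fun c _ => ?_
      simp only [signMul, Pi.add_apply]
      push_cast
      ring
    rw [hexp]
    ring
  simp_rw [hinner]
  rw [integral_const_mul, integral_const_mul, ksTerm, Complex.real_smul]
  ring

/-- The sign integrand is continuous in `a`. [folklore] -/
theorem continuous_signIntegrand (β : ℝ) (S : PIdx d n → ℝ) {z : ℕ → ℝ} (κ : CIdx d n → ℕ) (s : CIdx d n → SignType)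
    (b : QIdx d n → ℝ) : Continuous (signIntegrand β S (z := z) κ s b) := by
  unfold signIntegrand
  refine (continuous_ofReal.comp (continuous_auxGauss β)).mul
    (continuous_finsetProd _ fun c _ => continuous_const.mul (Complex.continuous_exp.comp ?_))
  exact continuous_const.mul (continuous_ofReal.comp (continuous_const.mul
    (((continuous_apply c).add continuous_const).add continuous_const)))

/-- The sign integrand is integrable in `a` (`β > 0`). [folklore] -/
theorem integrable_signIntegrand {β : ℝ} (hβ : 0 < β) (S : PIdx d n → ℝ) {z : ℕ → ℝ} (κ : CIdx d n → ℕ)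
    (s : CIdx d n → SignType) (b : QIdx d n → ℝ) : Integrable (signIntegrand β S (z := z) κ s b) := by
  refine ((integrable_auxGauss hβ).mul_const (∏ c, (EnsembleExpansion.pairWeight (uSeq z) (κ c) (s c)).toReal)).mono'
    (continuous_signIntegrand β S κ s b).aestronglyMeasurable (Filter.Eventually.of_forall fun a => le_of_eq ?_)
  unfold signIntegrand
  rw [norm_mul, Complex.norm_real, Real.norm_eq_abs, abs_of_pos (auxGauss_pos β a), norm_prod]
  congr 1
  refine Finset.prod_congr rfl fun c _ => ?_
  rw [norm_mul, Complex.norm_real, Real.norm_eq_abs, abs_of_nonneg ENNReal.toReal_nonneg, mul_comm I,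
    Complex.norm_exp_ofReal_mul_I, mul_one]

/-- **The sign sum of the resummation at fixed multiplicities**: inside the integrals the finite
sum over sign patterns is the product `∏_c u_{κ_c}(1 + z_{κ_c} cos(κ_c(a_c + ψ_c + 2π(Eᵀb)_c)))`.
[cite: FrohlichSpencerCMP1982, §2.6 (2.39)–(2.40)] -/
theorem sum_signIntegrand {β : ℝ} (S : PIdx d n → ℝ) {z : ℕ → ℝ} (hz : ∀ k, 0 < z k) (κ : CIdx d n → ℕ)
    (b : QIdx d n → ℝ) (a : CIdx d n → ℝ) :
    ∑ s : CIdx d n → SignType, signIntegrand β S (z := z) κ s b a =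
      (((∏ c, uR z (κ c)) * (auxGauss β a *
        ∏ c, (1 + z (κ c) * Real.cos (κ c * (a c + auxShift S c + torusShift b c)))) : ℝ) : ℂ) := by
  classical
  unfold signIntegrand
  rw [← Finset.mul_sum, ← Fintype.piFinset_univ,
    ← Finset.prod_univ_sum (fun _ => (Finset.univ : Finset SignType))
      (fun c s => (((EnsembleExpansion.pairWeight (uSeq z) (κ c) s).toReal : ℂ) *
        cexp (I * ((((s : ℤ) * (κ c) * (a c + auxShift S c + torusShift b c)) : ℝ) : ℂ))))]
  rw [Finset.prod_congr rfl fun c _ => sum_pairWeight_cexp hz (κ c) (a c + auxShift S c + torusShift b c),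
    ← Complex.ofReal_prod, ← Complex.ofReal_mul, Finset.prod_mul_distrib]
  push_cast
  ring

/-- **The `κ`-th term of the resummed gas** (FS82 (2.40), one multiplicity pattern):
`∑_s w(κ,s) T(sκ) = (∏_c u_{κ_c}) Z⁻¹ ∫_{[0,1)^Q} ∫ e^{-½aᵀPa} ∏_c (1 + z_{κ_c} cos(κ_c(a_c + ψ_c + 2π(Eᵀb)_c))) da db`.
[cite: FrohlichSpencerCMP1982, §2.6 (2.40)] -/
theorem sum_pairWeight_ksTerm {β : ℝ} (hβ : 0 < β) (S : PIdx d n → ℝ) {z : ℕ → ℝ} (hz : ∀ k, 0 < z k)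
    (κ : CIdx d n → ℕ) :
    ∑ s : CIdx d n → SignType,
        (∏ c, EnsembleExpansion.pairWeight (uSeq z) (κ c) (s c)).toReal • ksTerm β S (signMul s κ) =
      ((((∏ c, uR z (κ c)) * ((auxZ (d := d) (n := n) β)⁻¹ *
          ∫ b in Set.pi univ (fun _ : QIdx d n => Ico (0 : ℝ) 1), ∫ a, auxGauss β a *
            ∏ c, (1 + z (κ c) * Real.cos (κ c * (a c + auxShift S c + torusShift b c))))) : ℝ) : ℂ) := by
  classical
  simp_rw [pairWeight_smul_ksTerm β S κ]
  rw [← Finset.mul_sum]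
  -- integrability in `b` of the inner integrals (bounded continuous functions on the box)
  have hb : ∀ s : CIdx d n → SignType, IntegrableOn
      (fun b : QIdx d n → ℝ => ∫ a, signIntegrand β S (z := z) κ s b a)
      (Set.pi univ (fun _ : QIdx d n => Ico (0 : ℝ) 1)) := by
    intro s
    -- closed form in `b`
    have hcf : (fun b : QIdx d n → ℝ => ∫ a, signIntegrand β S (z := z) κ s b a) = fun b =>
        ((((∏ c, EnsembleExpansion.pairWeight (uSeq z) (κ c) (s c)).toReal : ℝ) : ℂ) *
          ∫ a, (auxGauss β a : ℂ) *
            cexp (I * (((fun c => ((signMul s κ c : ℤ) : ℝ)) ⬝ᵥ (a + auxShift S) : ℝ) : ℂ))) *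
          cexp (I * (((fun c => ((signMul s κ c : ℤ) : ℝ)) ⬝ᵥ torusShift b : ℝ) : ℂ)) := by
      funext b
      rw [show (∫ a, signIntegrand β S (z := z) κ s b a) =
        (((∏ c, EnsembleExpansion.pairWeight (uSeq z) (κ c) (s c)).toReal : ℝ) : ℂ) *
          ((∫ a, (auxGauss β a : ℂ) *
              cexp (I * (((fun c => ((signMul s κ c : ℤ) : ℝ)) ⬝ᵥ (a + auxShift S) : ℝ) : ℂ))) *
            cexp (I * (((fun c => ((signMul s κ c : ℤ) : ℝ)) ⬝ᵥ torusShift b : ℝ) : ℂ))) from ?_]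
      · ring
      · rw [← integral_mul_const, ← integral_const_mul]
        refine integral_congr_ae (Filter.Eventually.of_forall fun a => ?_)
        simp only [signIntegrand]
        rw [Finset.prod_mul_distrib, ENNReal.toReal_prod, Complex.ofReal_prod]
        have hexp : ∏ c, cexp (I * ((((s c : ℤ) * (κ c) * (a c + auxShift S c + torusShift b c)) : ℝ) : ℂ)) =
            cexp (I * (((fun c => ((signMul s κ c : ℤ) : ℝ)) ⬝ᵥ (a + auxShift S) : ℝ) : ℂ)) *
              cexp (I * (((fun c => ((signMul s κ c : ℤ) : ℝ)) ⬝ᵥ torusShift b : ℝ) : ℂ)) := by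
          rw [← Complex.exp_sum, ← Complex.exp_add]
          congr 1
          rw [dotProduct, dotProduct, Complex.ofReal_sum, Complex.ofReal_sum, Finset.mul_sum, Finset.mul_sum,
            ← Finset.sum_add_distrib]
          refine Finset.sum_congr rfl fun c _ => ?_
          simp only [signMul, Pi.add_apply]
          push_cast
          ring
        rw [hexp]
        ring
    rw [hcf]
    have hcont : Continuous fun b : QIdx d n → ℝ =>
        ((((∏ c, EnsembleExpansion.pairWeight (uSeq z) (κ c) (s c)).toReal : ℝ) : ℂ) *
          ∫ a, (auxGauss β a : ℂ) *
            cexp (I * (((fun c => ((signMul s κ c : ℤ) : ℝ)) ⬝ᵥ (a + auxShift S) : ℝ) : ℂ))) *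
          cexp (I * (((fun c => ((signMul s κ c : ℤ) : ℝ)) ⬝ᵥ torusShift b : ℝ) : ℂ)) := by
      refine continuous_const.mul (Complex.continuous_exp.comp (continuous_const.mul (continuous_ofReal.comp ?_)))
      exact continuous_const.dotProduct continuous_torusShift
    refine Measure.integrableOn_of_bounded (M := ‖(((∏ c, EnsembleExpansion.pairWeight (uSeq z) (κ c) (s c)).toReal : ℝ) : ℂ) *
          ∫ a, (auxGauss β a : ℂ) *
            cexp (I * (((fun c => ((signMul s κ c : ℤ) : ℝ)) ⬝ᵥ (a + auxShift S) : ℝ) : ℂ))‖) ?_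
      hcont.aestronglyMeasurable (Filter.Eventually.of_forall fun b => ?_)
    · refine (Bornology.IsBounded.measure_lt_top ?_).ne
      refine (Metric.isBounded_Icc (fun _ => 0 : QIdx d n → ℝ) (fun _ => 1)).subset ?_
      intro b hb
      simp only [Set.mem_pi, Set.mem_univ, forall_const, Set.mem_Ico] at hb
      exact ⟨fun σ => (hb σ).1, fun σ => (hb σ).2.le⟩
    · rw [norm_mul, mul_comm I, Complex.norm_exp_ofReal_mul_I, mul_one]
  rw [← integral_finsetSum _ (fun s _ => hb s)]
  have hinner : ∀ b : QIdx d n → ℝ, ∑ s : CIdx d n → SignType, ∫ a, signIntegrand β S (z := z) κ s b a =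
      ((((∏ c, uR z (κ c)) * ∫ a, auxGauss β a *
          ∏ c, (1 + z (κ c) * Real.cos (κ c * (a c + auxShift S c + torusShift b c)))) : ℝ) : ℂ) := by
    intro b
    rw [← integral_finsetSum _ (fun s _ => integrable_signIntegrand hβ S κ s b),
      integral_congr_ae (Filter.Eventually.of_forall fun a => sum_signIntegrand (β := β) S hz κ b a),
      integral_complex_ofReal, integral_const_mul]
  rw [integral_congr_ae (Filter.Eventually.of_forall hinner), integral_complex_ofReal, integral_const_mul]
  push_cast
  ring

/-- **FS82 (2.40), regulator-free, for the Villain model on a cube (the input of Lemma 2)**: for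
`β > 0` and activities `z_k > 0` with `∑_{k ≥ 1} 2/z_k = 1`,
`gasNum β S = ∑_{κ ∈ ℕ^{cubes}} (∏_c u_{κ_c}) Z⁻¹ ∫_{[0,1)^Q} ∫ e^{-½aᵀPa} ∏_c (1 + z_{κ_c} cos(κ_c (a_c + ψ_c + 2π(Eᵀb)_c))) da db`,
the `κ`-family being summable. [cite: FrohlichSpencerCMP1982, §2.6 (2.36)–(2.44)] -/
theorem gasNum_eq_tsum_kappa {β : ℝ} (hβ : 0 < β) {z : ℕ → ℝ} (hz : ∀ k, 0 < z k) (hsum : HasSum (uR z) 1)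
    (S : PIdx d n → ℝ) :
    Summable (fun κ : CIdx d n → ℕ => (∏ c, uR z (κ c)) * ((auxZ (d := d) (n := n) β)⁻¹ *
        ∫ b in Set.pi univ (fun _ : QIdx d n => Ico (0 : ℝ) 1), ∫ a, auxGauss β a *
          ∏ c, (1 + z (κ c) * Real.cos (κ c * (a c + auxShift S c + torusShift b c))))) ∧
      gasNum β S = ∑' κ : CIdx d n → ℕ, (∏ c, uR z (κ c)) * ((auxZ (d := d) (n := n) β)⁻¹ *
        ∫ b in Set.pi univ (fun _ : QIdx d n => Ico (0 : ℝ) 1), ∫ a, auxGauss β a *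
          ∏ c, (1 + z (κ c) * Real.cos (κ c * (a c + auxShift S c + torusShift b c)))) := by
  classical
  obtain ⟨hsumm, heq⟩ := tsum_eq_tsum_pairWeight_of_summable (uSeq z) (tsum_uSeq hz hsum) (ksTerm β S)
    (summable_norm_ksTerm hβ S)
  set f : (CIdx d n → ℕ) × (CIdx d n → SignType) → ℂ := fun p =>
    (∏ c, EnsembleExpansion.pairWeight (uSeq z) (p.1 c) (p.2 c)).toReal • ksTerm β S (signMul p.2 p.1) with hf
  have hfs : Summable f := by
    refine Summable.of_norm (hsumm.congr fun p => ?_)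
    rw [hf, norm_smul, Real.norm_eq_abs, abs_of_nonneg ENNReal.toReal_nonneg]
  have hinner : ∀ κ : CIdx d n → ℕ, ∑' s : CIdx d n → SignType, f (κ, s) =
      ((((∏ c, uR z (κ c)) * ((auxZ (d := d) (n := n) β)⁻¹ *
          ∫ b in Set.pi univ (fun _ : QIdx d n => Ico (0 : ℝ) 1), ∫ a, auxGauss β a *
            ∏ c, (1 + z (κ c) * Real.cos (κ c * (a c + auxShift S c + torusShift b c))))) : ℝ) : ℂ) := by
    intro κ
    rw [tsum_fintype]
    exact sum_pairWeight_ksTerm hβ S hz κ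
  have hprodsum : Summable fun κ : CIdx d n → ℕ => ∑' s : CIdx d n → SignType, f (κ, s) := hfs.prod
  simp_rw [hinner] at hprodsum
  refine ⟨Complex.summable_ofReal.1 hprodsum, ?_⟩
  rw [gasNum_eq_re_tsum hβ, heq]
  change (∑' p, f p).re = _
  rw [hfs.tsum_prod]
  simp_rw [hinner]
  rw [← Complex.ofReal_tsum, Complex.ofReal_re]

/-- **FS82 (2.40) for the partition function**: `gasDen β = ∑_κ (∏_c u_{κ_c}) Z⁻¹ ∫∫ e^{-½aᵀPa}
∏_c (1 + z_{κ_c} cos(κ_c (a_c + 2π(Eᵀb)_c))) da db`. [cite: FrohlichSpencerCMP1982, §2.6 (2.40)] -/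
theorem gasDen_eq_tsum_kappa {β : ℝ} (hβ : 0 < β) {z : ℕ → ℝ} (hz : ∀ k, 0 < z k) (hsum : HasSum (uR z) 1) :
    Summable (fun κ : CIdx d n → ℕ => (∏ c, uR z (κ c)) * ((auxZ (d := d) (n := n) β)⁻¹ *
        ∫ b in Set.pi univ (fun _ : QIdx d n => Ico (0 : ℝ) 1), ∫ a, auxGauss β a *
          ∏ c, (1 + z (κ c) * Real.cos (κ c * (a c + torusShift b c))))) ∧
      gasDen (d := d) (n := n) β = ∑' κ : CIdx d n → ℕ, (∏ c, uR z (κ c)) * ((auxZ (d := d) (n := n) β)⁻¹ *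
        ∫ b in Set.pi univ (fun _ : QIdx d n => Ico (0 : ℝ) 1), ∫ a, auxGauss β a *
          ∏ c, (1 + z (κ c) * Real.cos (κ c * (a c + torusShift b c)))) := by
  have h := gasNum_eq_tsum_kappa (d := d) (n := n) hβ hz hsum 0
  simp only [auxShift_zero, Pi.zero_apply, add_zero] at h
  exact h

end VillainAngle

end Literature.MathematicalPhysics.QuantumFieldTheory
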